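import Summits.Ventures.PercRepro.C026ProdCSLemmaB

/-!
# THEOREM PROD ((CS) composition): the product theorem for `K` (p5, gen 16)

mine-3's THEOREM PROD (`proofs/MINE3-PRODUCT.md` §1): for normalized generators `g₁, …, g_k ∈ K`,
`N² ≤ 𝒜ℬ` — the (CS) inequality composes under the one-sided square rooms (C4). The proof is
mine-3's: induction on the number `m` of generators NOT in `E1` (the independent ones). `m = 0` is
Lemma A (`sq_le_of_forall_isE1`). For `m + 1`: pick a generator `gᵢ ∉ E1`; if `uᵢ = vᵢ = 0` it acts
as the identity (`N` unchanged, `𝒜, ℬ` not decreased) and the family without it has `m` bad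
generators; otherwise Lemma B writes `gᵢ = (1 − λ)·id + λ·g′` with `g′` dominated by `e(a, b) ∈ E1`,
the triple `(N, 𝒜, ℬ)` is affine in `gᵢ` (`N_eq_rest` …), the family with `e(a, b)` in place of `gᵢ`
has `m` bad generators, domination and monotonicity pass (CS) from it to the family with `g′`, and
the cone `N² ≤ 𝒜ℬ` is convex (`sq_le_of_convex`).

* `linearity_N`, `linearity_calA`, `linearity_calB` — the affine decomposition at one index;
* `badCount_erase`, `badCount_update_e` — the bookkeeping of the bad generators;
* **`prod_cs`** — THEOREM PROD: `CS s g` for every finite family in `K`.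
-/

namespace PercRepro

namespace ProdCS

open Finset Gen

variable {ι : Type*} [DecidableEq ι]

/-! ### The affine decomposition at one index -/

/-- `N` is affine in the generator at `i`: if `gᵢ = (1 − λ)·id + λ·g′` coordinatewise, then
`N s g = (1 − λ) N (s ∖ i) g + λ N s (g[i := g′])`. -/
theorem linearity_N {s : Finset ι} {g : ι → Gen} {i : ι} (hi : i ∈ s) {l : ℝ} {g' : Gen}
    (hζ : (g i).ζ = (1 - l) + l * g'.ζ) (hρ : (g i).ρ = l * g'.ρ) (hσ : (g i).σ = l * g'.σ)
    (hν : (g i).ν = l * g'.ν) :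
    N s g = (1 - l) * N (s.erase i) g + l * N s (Function.update g i g') := by
  rw [N_eq_rest hi, N_eq_rest hi, Function.update_self, prod_erase_update (fun x => 1 - x.v),
    prod_erase_update (fun x => 1 - x.u), prod_erase_update (fun x => x.ζ)]
  unfold N
  have hu : (g i).u = l * g'.u := by unfold Gen.u; rw [hρ, hν]; ring
  have hv : (g i).v = l * g'.v := by unfold Gen.v; rw [hσ, hν]; ring
  rw [hu, hv, hζ]
  ring

/-- `𝒜` is affine in the generator at `i`. -/
theorem linearity_calA {s : Finset ι} {g : ι → Gen} {i : ι} (hi : i ∈ s) {l : ℝ} {g' : Gen}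
    (hα : (g i).α = l * g'.α) :
    calA s g = (1 - l) * calA (s.erase i) g + l * calA s (Function.update g i g') := by
  rw [calA_eq_rest hi, calA_eq_rest hi, Function.update_self, prod_erase_update (fun x => 1 + x.α)]
  unfold calA
  rw [hα]
  ring

/-- `ℬ` is affine in the generator at `i`. -/
theorem linearity_calB {s : Finset ι} {g : ι → Gen} {i : ι} (hi : i ∈ s) {l : ℝ} {g' : Gen}
    (hβ : (g i).β = l * g'.β) :
    calB s g = (1 - l) * calB (s.erase i) g + l * calB s (Function.update g i g') := by
  rw [calB_eq_rest hi, calB_eq_rest hi, Function.update_self, prod_erase_update (fun x => 1 + x.β)]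
  unfold calB
  rw [hβ]
  ring

/-! ### Bookkeeping of the bad generators -/

open Classical in
/-- The bad generators of the family without `i`. -/
theorem badCount_erase {s : Finset ι} {g : ι → Gen} {i : ι} (hi : i ∈ s) (hbad : ¬ IsE1 (g i)) :
    ((s.erase i).filter fun j => ¬ IsE1 (g j)).card = (s.filter fun j => ¬ IsE1 (g j)).card - 1 := by
  rw [Finset.filter_erase, Finset.card_erase_of_mem (Finset.mem_filter.mpr ⟨hi, hbad⟩)]

open Classical in
/-- The bad generators of the family with `e(a, b) ∈ E1` in place of `gᵢ`. -/
theorem badCount_update_e {s : Finset ι} {g : ι → Gen} {i : ι} (hi : i ∈ s) (hbad : ¬ IsE1 (g i))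
    {a b : ℝ} (ha0 : 0 ≤ a) (ha1 : a ≤ 1) (hb0 : 0 ≤ b) (hb1 : b ≤ 1) (hab : 1 ≤ a + b) :
    (s.filter fun j => ¬ IsE1 (Function.update g i (e a b) j)).card =
      (s.filter fun j => ¬ IsE1 (g j)).card - 1 := by
  rw [← Finset.card_erase_of_mem (Finset.mem_filter.mpr ⟨hi, hbad⟩)]
  congr 1
  ext j
  simp only [Finset.mem_filter, Finset.mem_erase]
  by_cases hj : j = i
  · subst hj
    simp only [Function.update_self, ne_eq, not_true_eq_false, false_and, iff_false, not_and,
      not_not]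
    intro _
    exact ⟨a, b, ha0, ha1, hb0, hb1, hab, rfl⟩
  · rw [Function.update_of_ne hj]
    tauto

/-- Membership in `K` for the family with the generator at `i` replaced. -/
theorem memK_update {s : Finset ι} {g : ι → Gen} {i : ι} (hK : ∀ j ∈ s, MemK (g j)) {h : Gen}
    (hh : MemK h) : ∀ j ∈ s, MemK (Function.update g i h j) := by
  intro j hj
  by_cases hji : j = i
  · subst hji; rw [Function.update_self]; exact hh
  · rw [Function.update_of_ne hji]; exact hK j hj

/-! ### THEOREM PROD -/

/-- `u`, `v` of `e(a, b)`. -/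
theorem e_u (a b : ℝ) : (e a b).u = a := by simp only [Gen.u, Gen.e]; ring

/-- `u`, `v` of `e(a, b)`. -/
theorem e_v (a b : ℝ) : (e a b).v = b := by simp only [Gen.v, Gen.e]; ring

open Classical in
/-- The induction on the number of bad generators. -/
theorem prod_cs_aux (m : ℕ) :
    ∀ (s : Finset ι) (g : ι → Gen), (∀ i ∈ s, MemK (g i)) →
      (s.filter fun j => ¬ IsE1 (g j)).card = m → CS s g := by
  induction m with
  | zero =>
    intro s g _ hm
    refine sq_le_of_forall_isE1 fun i hi => ?_
    by_contra h
    have : i ∈ s.filter fun j => ¬ IsE1 (g j) := Finset.mem_filter.mpr ⟨hi, h⟩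
    rw [Finset.card_eq_zero] at hm
    rw [hm] at this
    exact Finset.notMem_empty i this
  | succ m ih =>
    intro s g hK hm
    -- a bad generator `gᵢ`
    obtain ⟨i, hi⟩ : (s.filter fun j => ¬ IsE1 (g j)).Nonempty := by
      rw [← Finset.card_pos, hm]; omega
    rw [Finset.mem_filter] at hi
    obtain ⟨his, hbad⟩ := hi
    have hKi := hK i his
    have hKrest : ∀ j ∈ s.erase i, MemK (g j) := fun j hj => hK j (Finset.mem_of_mem_erase hj)
    have hm' : ((s.erase i).filter fun j => ¬ IsE1 (g j)).card = m := by
      rw [badCount_erase his hbad, hm]; rfl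
    have hrest : CS (s.erase i) g := ih (s.erase i) g hKrest hm'
    have hA0 := calA_nonneg hKrest
    have hB0 := calB_nonneg hKrest
    by_cases hzero : (g i).u = 0 ∧ (g i).v = 0
    · -- `gᵢ` acts as the identity
      have hρ0 : (g i).ρ = 0 := by
        have := hzero.1; unfold Gen.u at this; linarith [hKi.ρ_nonneg, hKi.ν_nonneg]
      have hσ0 : (g i).σ = 0 := by
        have := hzero.2; unfold Gen.v at this; linarith [hKi.σ_nonneg, hKi.ν_nonneg]
      have hν0 : (g i).ν = 0 := by
        have := hzero.1; unfold Gen.u at this; linarith [hKi.ρ_nonneg, hKi.ν_nonneg]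
      have hζ1 : (g i).ζ = 1 := by linarith [hKi.norm]
      have hN : N s g = N (s.erase i) g := by
        rw [N_eq_rest his]; unfold N; rw [hzero.1, hzero.2, hζ1]; ring
      have hA : calA (s.erase i) g ≤ calA s g := by
        rw [calA_eq_rest his]; unfold calA
        have : (0 : ℝ) ≤ ∏ j ∈ s.erase i, (1 + (g j).α) :=
          Finset.prod_nonneg fun j hj => by linarith [(hKrest j hj).α_nonneg]
        nlinarith [hKi.α_nonneg]
      have hB : calB (s.erase i) g ≤ calB s g := by
        rw [calB_eq_rest his]; unfold calB
        have : (0 : ℝ) ≤ ∏ j ∈ s.erase i, (1 + (g j).β) :=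
          Finset.prod_nonneg fun j hj => by linarith [(hKrest j hj).β_nonneg]
        nlinarith [hKi.β_nonneg]
      unfold CS at hrest ⊢
      rw [hN]
      exact hrest.trans (mul_le_mul hA hB hB0 (hA0.trans hA))
    · -- Lemma B
      have hne : 0 < (g i).u ∨ 0 < (g i).v := by
        have hu := (u_mem hKi).1
        have hv := (v_mem hKi).1
        by_contra h
        push Not at h
        exact hzero ⟨le_antisymm (h.1) hu, le_antisymm (h.2) hv⟩
      obtain ⟨l, g', a, b, hl0, hl1, hK', hζ, hρ, hσ, hν, hα, hβ, ha0, ha1, hb0, hb1, hab,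
        hu', hv', hν', hα', hβ'⟩ := lemmaB hKi hne
      -- the family with `e(a, b)` at `i` satisfies (CS) by the induction hypothesis
      have hKe : ∀ j ∈ s, MemK (Function.update g i (e a b) j) :=
        memK_update hK (memK_e ha0 ha1 hb0 hb1 hab)
      have hme : (s.filter fun j => ¬ IsE1 (Function.update g i (e a b) j)).card = m := by
        rw [badCount_update_e his hbad ha0 ha1 hb0 hb1 hab, hm]; rfl
      have hCSe : CS s (Function.update g i (e a b)) := ih s _ hKe hme
      -- domination passes (CS) to the family with `g′` at `i`
      have hKg' : ∀ j ∈ s, MemK (Function.update g i g' j) := memK_update hK hK'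
      have hζ' : g'.ζ = 1 - g'.u - g'.v + g'.ν := by
        unfold Gen.u Gen.v; linarith [hK'.norm]
      have hζe : (e a b).ζ = 1 - (e a b).u - (e a b).v + (e a b).ν := by
        simp only [Gen.u, Gen.v, Gen.e]; ring
      have hNle : N s (Function.update g i g') ≤ N s (Function.update g i (e a b)) :=
        N_update_mono hKrest his (by rw [e_u]; exact hu') (by rw [e_v]; exact hv') hν' hζ' hζe
      have hN0 : 0 ≤ N s (Function.update g i g') := N_nonneg hKg'
      have hAle : calA s (Function.update g i (e a b)) ≤ calA s (Function.update g i g') :=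
        calA_update_mono hKrest his hα'
      have hBle : calB s (Function.update g i (e a b)) ≤ calB s (Function.update g i g') :=
        calB_update_mono hKrest his hβ'
      have hAe0 := calA_nonneg hKe
      have hBe0 := calB_nonneg hKe
      have hCSg' : CS s (Function.update g i g') := by
        unfold CS at hCSe ⊢
        calc N s (Function.update g i g') ^ 2 ≤ N s (Function.update g i (e a b)) ^ 2 :=
              pow_le_pow_left₀ hN0 hNle 2
          _ ≤ calA s (Function.update g i (e a b)) * calB s (Function.update g i (e a b)) := hCSe
          _ ≤ calA s (Function.update g i g') * calB s (Function.update g i g') :=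
              mul_le_mul hAle hBle hBe0 (hAe0.trans hAle)
      -- convexity
      unfold CS at hrest hCSg' ⊢
      rw [linearity_N his hζ hρ hσ hν, linearity_calA his hα, linearity_calB his hβ]
      exact sq_le_of_convex hA0 hB0 (hAe0.trans hAle) (hBe0.trans hBle) hrest hCSg'
        (by linarith) hl0.le

/-- **THEOREM PROD** (mine-3, `MINE3-PRODUCT.md` §1): for a finite family of normalized
generators in `K` — nonnegative, `ζ + ρ + σ + ν = 1`, `ρ ≤ α`, `σ ≤ β`, `ν² ≤ αβ`, `u² ≤ α`,
`v² ≤ β` — the product satisfies (CS): `N² ≤ 𝒜ℬ`, with `N = 1 − Π (1 − vᵢ) − Π (1 − uᵢ) + Π ζᵢ`,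
`𝒜 = Π (1 + αᵢ) − 1`, `ℬ = Π (1 + βᵢ) − 1`. -/
theorem prod_cs (s : Finset ι) (g : ι → Gen) (hK : ∀ i ∈ s, MemK (g i)) : CS s g := by
  classical
  exact prod_cs_aux _ s g hK rfl

end ProdCS

end PercRepro
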